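import Literature.NumberTheory.GelbartRogawski1991.ThetaDichotomyVocabulary
import Literature.NumberTheory.GelbartRogawski1991.U1ThetaDichotomy
import Literature.NumberTheory.Automorphic.UnitaryGroupLocalCenterScalar
import Literature.NumberTheory.Automorphic.UnitaryGroupNonsplitTorus
import Literature.NumberTheory.Automorphic.Liu2021.Def411IrreducibleOfLemD1AsPrinted
import Literature.NumberTheory.Automorphic.Liu2021.LemD1AsPrintedIndexedNonVacuityNonsplitPlace
import Literature.NumberTheory.Automorphic.Liu2021.LocalNormClassFlip
import Literature.NumberTheory.QuadraticForms.PrescribedNormClassesCM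
import Literature.NumberTheory.NumberFields.CMFieldTotallyNegativeGenerator
import HarnessLib

/-!
# Crux `H413`, programme P2, U′-N pay-down line `F0_P2GR91NJacquet` — K1 sub-line `F0_P2GR91NJacquetK1`, stub K1aʷ:
# the OCCURRENCE piece «K1occ» — `∃ ε`, the theta centre character `ψθ` OCCURS in `ω¹(γ_v, ψ_v)` at the line `⟨ε⟩`

Cell `hodgecm-mathlib` (D-0151), FLOOR 0, crux item H413 = stmt-HodgeConjecture-24833; registered K1 sub-line
`Cruxes/H413/Lines/F0_P2GR91NJacquetK1.lean` (58d7bd08daa5 ∕ v3a 368644d96141), stub `stub_K1aW : StubK1aWJacquetFunctional`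
(closer F0P2-p02 (g5) `Theorems/F0P2oK1aWOfN3.lean` over ★ N3ᵟ `GelbartRogawski1991.thetaType_nonsplit_borelEigenfunctional`,
whose hypothesis `OccursInLineWeilCM … ε v ψθ` is NOT supplied by N3 ∕ N3ᵟ ∕ K1m ∕ K1c — p02 (g5) 15:08:32Z (4), desk F0P2-plan (g7)
15:10:23Z ∕ 15:13:08Z).  THIS FILE (F0P2-p01 (g7), kernel lane `--supports stmt-HodgeConjecture-24833 --as helper`) supplies it:

* §1 `continuous_of_isThetaCenterChar` — a character `ψθ` of `E¹_v` satisfying ★ `IsThetaCenterChar L μ χf ε v ψθ`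
  (`ψθ(det u) = χ_{f,v}(u)·μ_v(det u)⁻¹` on `U(JW ε)(L⁺_v)`) is CONTINUOUS when `χ_f` is (it factors through the continuous section
  `β ↦ (β)` ★ `localUnitScalar`, ★ `continuous_localCharOfCenter`, ★ `continuous_semilocalComponent`); with
  `localDet_localPiEquiv_localUnitScalar` (`det (β) = β`).
* §2 `exists_units_not_isNorm_of_nonsplit` — at a finite place `v` of `L⁺` NOT split in the CM field `L` there is a GLOBAL
  `θ ∈ (L⁺)ˣ` which is not a local norm from `(L ⊗ L⁺_v)ˣ` (local norm index two ★ `index_quadraticNormSubgroup_adicCompletion_eq_two`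
  + global elements with prescribed local norm classes ★ `QuadraticForms.exists_prescribed_normClass_of_finite`).
* §3 `k1occ_of_dichotomy` — the K1occ text `∀ ‹data› v (non-split) ε₀ ψθ, IsThetaCenterChar L μ χf ε₀ v ψθ → ∃ ε, OccursInLineWeilCM L e₀
  (kernelLineCM dV) … μ hμ ε v ψθ` from the `(U(1), U(1))` DICHOTOMY IN CM CURRENCY, taken as the hypothesis `hD` (its text =
  `F0/P2/p01/HDICH-binder.v2.F0P2p01g7.lean`, to be proved in-house by F0P2-p06 (g0), `Theorems/F0P2oCMSectionsThetaOne.lean`, over ★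
  `MoeglinVignerasWaldspurger1987.rankOne_theta_dichotomy` — or booked as the print letter [GelbartRogawski1991 Remark p. 466, Cor. 5.2.2;
  Rogawski1992 Prop. 3.4; HarrisKudlaSweet1996 Thm. 6.1 (n = 1)] if the θ-pinning resists): apply `hD` to the pair `(ε₀, θ·ε₀)`.

HONEST LABEL: HC_CM is proved only modulo the printed citations until rung 0 closes; this file proves no letter — §3 is CONDITIONAL on `hD`.

ED.2 (lead B-p18 (g28) 15:23:45Z (2); referee r150 (B), r152): §4 `isOpen_ker_of_isThetaCenterChar` (the theta centre character has OPEN KERNEL,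
the `hξ` form of ★ `rankOne_theta_dichotomy`'s consumers) and `continuous_coe_of_isOpen_ker`; §5 the
LETTER-SOURCED twin `k1occ_of_u1ThetaDichotomy (hU1 : u1ThetaDichotomy_nonsplit)` (same conclusion as `k1occ_of_dichotomy`) and
`u1ThetaDichotomy_nonsplit_of_dichotomy (hD) : u1ThetaDichotomy_nonsplit` (the in-house dichotomy `hD` pays the letter by one token).

## References
* [GelbartRogawski1991] S. Gelbart, J. Rogawski, Invent. Math. 105 (1991): Remark p. 466 («for given `γ` and `χ`, there exists a unique class of
  `ψ` such that `χ` occurs in `ω¹(γ, ψ)`»), Cor. 5.2.2 p. 467, §5.2 p. 467 L25–27.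
* [MoeglinVignerasWaldspurger1987] LNM 1291, Chap. 3 §IV.4 (the `(U(1), U(1))` dichotomy).
* [Rogawski1992] J. Rogawski, *The multiplicity formula for A-packets*, in: The zeta functions of Picard modular surfaces (1992), Prop. 3.4.
* [HarrisKudlaSweet1996] JAMS 9 (1996), Thm. 6.1 (n = 1).
* [Omeara1963] O. T. O'Meara, *Introduction to quadratic forms*, §63B Cor. 63:13a, §65 Prop. 65:21, §71 Thm. 71:19.
* [Mok2014] C. P. Mok, Mem. AMS 235 (2015), §1 Notation p. 5 (the centre `E¹`).
-/

set_option autoImplicit false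
-- the mandated namespace has the single-problem summit's repeated segment (`HodgeConjecture.HodgeConjecture`)
set_option linter.dupNamespace false

noncomputable section

open NumberField IsDedekindDomain
open scoped Matrix

open Literature.NumberTheory Literature.NumberTheory.Automorphic Literature.NumberTheory.Automorphic.UnitaryGroup
open Literature.NumberTheory.Automorphic.IdeleClassGroup
open Literature.NumberTheory.GaloisRepresentations
open Literature.NumberTheory.Automorphic.Liu2021 Literature.NumberTheory.Automorphic.Liu2021.Def411WeilCarriers
open Literature.NumberTheory.Rogawski1990
open Literature.NumberTheory.GelbartRogawski1991
open Literature.NumberTheory.QuadraticForms (quadraticNormSubgroup)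
open Literature.NumberTheory.NumberFields
open Literature.RepresentationTheory

namespace Summit.HodgeConjecture.HodgeConjecture.Cruxes.H413.F0P2oK1occ

/-! ## §1 The theta centre character is continuous -/

section Continuity

variable {F : Type} (E : Type) [Field F] [NumberField F] [Field E] [NumberField E] [Algebra F E]
  (c : E ≃ₐ[F] E) (J₁ : Matrix (Fin 1) (Fin 1) E) (v : HeightOneSpectrum (𝓞 F))

/-- **`det (β) = β`**: the determinant (★ `localDet`, through ★ `localPiEquiv`) of the norm-one scalar `(β) ∈ U(J₁)(F_v)`
(★ `localUnitScalar`) is `β`. [cite: Mok2014, §1 Notation p. 5] -/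
theorem localDet_localPiEquiv_localUnitScalar (hJ : IsUnit J₁.det) (z : (UnitaryGroup.LocalRing E v)ˣ)
    (hz : (z : UnitaryGroup.LocalRing E v) * conjLocal E c v z = 1) :
    ((localDet c v hJ (localPiEquiv E c 1 J₁ v (localUnitScalar E c J₁ v z hz)) : ↥(normOneUnits (conjLocal E c v))) :
        (UnitaryGroup.LocalRing E v)ˣ) = z := by
  rw [coe_localDet]
  refine Units.ext ?_
  rw [Matrix.GeneralLinearGroup.val_det_apply]
  change (((localPiEquiv E c 1 J₁ v (localUnitScalar E c J₁ v z hz)).1 : GL (Fin 1) (UnitaryGroup.LocalRing E v)).val).det = _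
  rw [coe_localPiEquiv_localUnitScalar, Matrix.det_fin_one, Matrix.smul_apply, Matrix.one_apply_eq, smul_eq_mul, mul_one]

/-- **the section `E¹_v → U(J₁)(F_v)`, `β ↦ (β)`, is continuous** (regrouping ★ `localGLPiEquiv` of the continuous `Units.map` of the
scalar embedding). [cite: Mok2014, §1 Notation p. 5] -/
theorem continuous_localUnitScalar_normOneUnits :
    Continuous fun β : ↥(normOneUnits (conjLocal E c v)) =>
      localUnitScalar E c J₁ v (β : (UnitaryGroup.LocalRing E v)ˣ)
        (by rw [mul_comm]; exact (mem_normOneUnits_iff (β : (UnitaryGroup.LocalRing E v)ˣ)).1 β.2) := by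
  have hsc : Continuous fun z : (UnitaryGroup.LocalRing E v)ˣ =>
      Units.map (Matrix.scalar (Fin 1) : UnitaryGroup.LocalRing E v →+* Matrix (Fin 1) (Fin 1) (UnitaryGroup.LocalRing E v)).toMonoidHom z := by
    refine Units.continuous_map ?_
    change Continuous fun a : UnitaryGroup.LocalRing E v => Matrix.scalar (Fin 1) a
    simp_rw [Matrix.scalar_apply]
    exact (continuous_pi fun _ => continuous_id).matrix_diagonal
  exact (((localGLPiEquiv E 1 v).continuous.comp (hsc.comp continuous_subtype_val))).subtype_mk _

end Continuity

set_option synthInstance.maxHeartbeats 400000 in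
set_option maxHeartbeats 8000000 in
/-- **The theta centre character is continuous.**  If `χ_f` is continuous and `ψθ` satisfies ★ `IsThetaCenterChar L μ χf ε v ψθ`
(`ψθ(det u) = χ_{f,v}(u)·μ_v(det u)⁻¹` for all `u ∈ U(JW ε)(L⁺_v)`), then `β ↦ ψθ β` is continuous on `E¹_v`: through the section
`β ↦ (β)` it reads `ψθ β = χ_{f,v}((β))·μ_v(β)⁻¹`, a product of continuous maps (★ `continuous_localCharOfCenter`,
★ `continuous_semilocalComponent`). [cite: GelbartRogawski1991, §5.1 (5.1.1) p. 465] [cite: Mok2014, §1 Notation p. 5] -/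
theorem continuous_of_isThetaCenterChar (L : Type) [Field L] [NumberField L] [IsCMField L]
    (μ : Literature.NumberTheory.Automorphic.IdeleClassGroup L →ₜ* Circle)
    (χf : UnitaryGroup.finAdelicOne (↥(maximalRealSubfield L)) L (IsCMField.complexConj L) →* ℂˣ) (hχ : Continuous χf)
    (ε : (↥(maximalRealSubfield L))ˣ) (v : HeightOneSpectrum (𝓞 ↥(maximalRealSubfield L)))
    (ψθ : ↥(normOneUnits (conjLocal L (IsCMField.complexConj L) v)) →* ℂˣ) (h : IsThetaCenterChar L μ χf ε v ψθ) :
    Continuous fun β => ((ψθ β : ℂˣ) : ℂ) := by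
  have hJ : IsUnit (JW (↥(maximalRealSubfield L)) L ε).det :=
    isUnit_iff_ne_zero.mpr (by rw [Matrix.det_fin_one]; exact JW_apply_ne_zero (↥(maximalRealSubfield L)) L ε)
  -- the section and its determinant
  set s : ↥(normOneUnits (conjLocal L (IsCMField.complexConj L) v)) →
      ↥(localPi L (IsCMField.complexConj L) 1 (JW (↥(maximalRealSubfield L)) L ε) v) := fun β =>
    localUnitScalar L (IsCMField.complexConj L) (JW (↥(maximalRealSubfield L)) L ε) v (β : (UnitaryGroup.LocalRing L v)ˣ)
      (by rw [mul_comm]; exact (mem_normOneUnits_iff (β : (UnitaryGroup.LocalRing L v)ˣ)).1 β.2) with hsdef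
  have hs : Continuous s := continuous_localUnitScalar_normOneUnits L (IsCMField.complexConj L) _ v
  have hdet : ∀ β, localDet (IsCMField.complexConj L) v hJ
      (localPiEquiv L (IsCMField.complexConj L) 1 (JW (↥(maximalRealSubfield L)) L ε) v (s β)) = β := fun β =>
    Subtype.ext (localDet_localPiEquiv_localUnitScalar L (IsCMField.complexConj L) _ v hJ _ _)
  -- `ψθ β = χ_{f,v}(s β) · μ_v(β)⁻¹`
  have key : ∀ β, ψθ β =
      localCharOfCenter (↥(maximalRealSubfield L)) L (IsCMField.complexConj L) (JW (↥(maximalRealSubfield L)) L ε)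
          (JW_apply_ne_zero (↥(maximalRealSubfield L)) L ε) χf v (s β) *
        ((toHeckeCharacter L μ).semilocalComponent L v (β : (UnitaryGroup.LocalRing L v)ˣ))⁻¹ := by
    intro β
    have h1 := h (s β)
    rw [hdet β] at h1
    exact h1
  have hfun : (fun β => ((ψθ β : ℂˣ) : ℂ)) = fun β =>
      ((localCharOfCenter (↥(maximalRealSubfield L)) L (IsCMField.complexConj L) (JW (↥(maximalRealSubfield L)) L ε)
          (JW_apply_ne_zero (↥(maximalRealSubfield L)) L ε) χf v (s β) : ℂˣ) : ℂ) *
        ((((toHeckeCharacter L μ).semilocalComponent L v (β : (UnitaryGroup.LocalRing L v)ˣ))⁻¹ : ℂˣ) : ℂ) := by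
    funext β; rw [key β, Units.val_mul]
  rw [hfun]
  refine ((continuous_coe_localCharOfCenter (↥(maximalRealSubfield L)) L (IsCMField.complexConj L) _ _ hχ v).comp hs).mul ?_
  exact Units.continuous_val.comp (continuous_inv.comp
    ((continuous_semilocalComponent L (v := v) (toHeckeCharacter L μ)).comp continuous_subtype_val))

/-! ## §2 A global non-norm at a non-split place -/

set_option maxHeartbeats 1600000 in
/-- **A GLOBAL non-norm at a non-split place.**  For a CM field `L` and a finite place `v` of `L⁺` that does not split in `L`
there is `θ ∈ (L⁺)ˣ` which is NOT a norm `x·x̄` from `(L ⊗ L⁺_v)ˣ`: the local norm group has index two at `v`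
(★ `index_quadraticNormSubgroup_adicCompletion_eq_two`, `δ²` is not a square in `L⁺_v`, ★ `not_isSquare_delta_sq_of_nonsplit`), and a
family of local norm classes non-trivial exactly at `v` is realised by one global element (★ `QuadraticForms.exists_prescribed_normClass_of_finite`,
for the totally negative `δ²` of ★ `IsCMField.exists_ringOfIntegers_totallyNegative_sqrt`).
[cite: Omeara1963, §63B Cor. 63:13a; §65 Prop. 65:21; §71 Thm. 71:19] -/
theorem exists_units_not_isNorm_of_nonsplit (L : Type) [Field L] [NumberField L] [IsCMField L]
    (v : HeightOneSpectrum (𝓞 ↥(maximalRealSubfield L)))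
    (hv : ∀ w : PlacesOver L v, IsCMField.complexConj L • w.1 = w.1) :
    ∃ θ : (↥(maximalRealSubfield L))ˣ, ¬ ∃ x : (UnitaryGroup.LocalRing L v)ˣ,
      (x : UnitaryGroup.LocalRing L v) * conjLocal L (IsCMField.complexConj L) v x =
        algebraMap L (UnitaryGroup.LocalRing L v) (((θ : ↥(maximalRealSubfield L))) : L) := by
  classical
  obtain ⟨θ₀, α, hα0, hcα, hsq, -, hneg⟩ := IsCMField.exists_ringOfIntegers_totallyNegative_sqrt L
  set d : ↥(maximalRealSubfield L) := (θ₀ : ↥(maximalRealSubfield L)) with hddef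
  have hd : α * α = algebraMap (↥(maximalRealSubfield L)) L d := by rw [← sq, hsq]
  have hd0L : algebraMap (↥(maximalRealSubfield L)) L d ≠ 0 := by rw [← hd]; exact mul_ne_zero hα0 hα0
  have hd0 : d ≠ 0 := fun h0 => hd0L (by rw [h0, map_zero])
  obtain ⟨w⟩ := (inferInstance : Nonempty (PlacesOver L v))
  -- `d` is not a square in `L⁺_v`, so the local norm-class group has two elements
  have hns : ¬ IsSquare (algebraMap (↥(maximalRealSubfield L)) (v.adicCompletion ↥(maximalRealSubfield L)) d) :=
    Liu2021.LemD1IndexedNonVacuityNonsplitPlace.not_isSquare_delta_sq_of_nonsplit L v (IsCMField.complexConj L) hcα hα0 w (hv w) hd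
  have h2 := Liu2021.RemD5.natCard_normClassGroup_eq_two v d hns
  obtain ⟨cls, hcls⟩ := Liu2021.RemD5.exists_ne_one_of_card_eq_two h2
  -- prescribe the class `cls` at `v` and the trivial class elsewhere
  set εfam : ∀ v' : HeightOneSpectrum (𝓞 ↥(maximalRealSubfield L)),
      (v'.adicCompletion ↥(maximalRealSubfield L))ˣ ⧸
        quadraticNormSubgroup (v'.adicCompletion ↥(maximalRealSubfield L))
          (algebraMap (↥(maximalRealSubfield L)) (v'.adicCompletion ↥(maximalRealSubfield L)) d) :=
    Function.update (fun _ => 1) v cls with hεfam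
  have hfin : {v' : HeightOneSpectrum (𝓞 ↥(maximalRealSubfield L)) | εfam v' ≠ 1}.Finite := by
    refine (Set.finite_singleton v).subset fun v' hv' => ?_
    by_contra hne
    exact hv' (by rw [hεfam, Function.update_of_ne hne])
  -- a real place of `L⁺`
  obtain ⟨w₀⟩ := (inferInstance : Nonempty (InfinitePlace ↥(maximalRealSubfield L)))
  have hw₀ : w₀.IsReal := IsTotallyReal.isReal w₀
  obtain ⟨θ, hθ⟩ := QuadraticForms.exists_prescribed_normClass_of_finite (↥(maximalRealSubfield L)) d hd0
    (fun w hw => hneg w hw) w₀ hw₀ εfam hfin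
  refine ⟨θ, fun hnorm => ?_⟩
  -- the class of `θ` at `v` is `cls ≠ 1`
  have hθv := hθ v
  rw [hεfam, Function.update_self] at hθv
  have hnot : Units.map (algebraMap (↥(maximalRealSubfield L)) (v.adicCompletion ↥(maximalRealSubfield L))).toMonoidHom θ ∉
      quadraticNormSubgroup (v.adicCompletion ↥(maximalRealSubfield L))
        (algebraMap (↥(maximalRealSubfield L)) (v.adicCompletion ↥(maximalRealSubfield L)) d) := by
    intro hmem
    exact hcls (by rw [← hθv]; exact (QuotientGroup.eq_one_iff _).2 hmem)
  refine hnot ((Liu2021.LemD1IndexedNonVacuityNonsplitPlace.isNorm_iff_mem_quadraticNormSubgroup L v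
    (IsCMField.complexConj L) hcα hα0 hd _).1 ?_)
  obtain ⟨x, hx⟩ := hnorm
  refine ⟨x, ?_⟩
  rw [hx]
  change algebraMap L (UnitaryGroup.LocalRing L v) (algebraMap (↥(maximalRealSubfield L)) L (θ : ↥(maximalRealSubfield L))) =
    algebraMap (v.adicCompletion ↥(maximalRealSubfield L)) (UnitaryGroup.LocalRing L v)
      (algebraMap (↥(maximalRealSubfield L)) (v.adicCompletion ↥(maximalRealSubfield L)) (θ : ↥(maximalRealSubfield L)))
  rw [← IsScalarTower.algebraMap_apply, ← IsScalarTower.algebraMap_apply]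

/-! ## §3 K1occ from the `(U(1), U(1))` dichotomy in CM currency -/

set_option synthInstance.maxHeartbeats 400000 in
set_option maxHeartbeats 8000000 in
/-- **K1occ — the OCCURRENCE piece of stub K1aʷ: for every theta centre character there is a line class at which it occurs.**
For a CM field `L`, frame `dV` (totally real, non-zero), reindexing `e₀`, conjugate-symplectic `μ`, continuous `χ_f`, a finite place `v`
of `L⁺` NOT split in `L`, a line `ε₀` and a character `ψθ` of `E¹_v` with ★ `IsThetaCenterChar L μ χf ε₀ v ψθ`: there is a line class `ε`
with ★ `OccursInLineWeilCM L e₀ (kernelLineCM dV) … μ hμ ε v ψθ` (the `ψθ`-part of GR's `ω¹(γ_v, ψ_v)` at the Witt kernel line and the line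
`⟨ε⟩` is non-zero) — CONDITIONAL on the `(U(1), U(1))` dichotomy in CM currency `hD` («of two line classes differing by a local non-norm,
exactly one carries `ψ`»; F0P2-p06 (g0) in-house over ★ `rankOne_theta_dichotomy`, text `F0/P2/p01/HDICH-binder.v2.F0P2p01g7.lean`):
apply `hD` to `(ε₀, θ·ε₀)` for a global non-norm `θ` (§2) and the continuity of `ψθ` (§1).
[cite: GelbartRogawski1991, Remark p. 466; Cor. 5.2.2 p. 467] [cite: MoeglinVignerasWaldspurger1987, Chap. 3 §IV.4] -/
theorem k1occ_of_dichotomy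
    (hD : ∀ (L : Type) [Field L] [NumberField L] [IsCMField L]
      {n₀ : ℕ} (e₀ : Fin 1 × Fin 1 ≃ Fin n₀) (dL : Fin 1 → L) (hdL : ∀ i, IsCMField.complexConj L (dL i) = dL i) (hdL0 : ∀ i, dL i ≠ 0)
      (μ : Literature.NumberTheory.Automorphic.IdeleClassGroup L →ₜ* Circle) (hμ : IsConjugateSymplectic L μ)
      (v : HeightOneSpectrum (𝓞 ↥(maximalRealSubfield L))),
      (∀ w : PlacesOver L v, IsCMField.complexConj L • w.1 = w.1) →
      ∀ (ε₁ ε₂ : (↥(maximalRealSubfield L))ˣ),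
        (¬ ∃ x : (UnitaryGroup.LocalRing L v)ˣ,
            (x : UnitaryGroup.LocalRing L v) * conjLocal L (IsCMField.complexConj L) v x =
              algebraMap L (UnitaryGroup.LocalRing L v) (((ε₂ * ε₁⁻¹ : (↥(maximalRealSubfield L))ˣ) : ↥(maximalRealSubfield L)) : L)) →
        ∀ (ψ : ↥(normOneUnits (conjLocal L (IsCMField.complexConj L) v)) →* ℂˣ),
          (Continuous fun β => ((ψ β : ℂˣ) : ℂ)) →
          (OccursInLineWeilCM L e₀ dL hdL hdL0 μ hμ ε₁ v ψ ∨ OccursInLineWeilCM L e₀ dL hdL hdL0 μ hμ ε₂ v ψ) ∧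
            ¬ (OccursInLineWeilCM L e₀ dL hdL hdL0 μ hμ ε₁ v ψ ∧ OccursInLineWeilCM L e₀ dL hdL hdL0 μ hμ ε₂ v ψ)) :
    ∀ (L : Type) [Field L] [NumberField L] [IsCMField L]
      {n₀ : ℕ} (e₀ : Fin 1 × Fin 1 ≃ Fin n₀) (dV : Fin 3 → L) (hdV : ∀ i, IsCMField.complexConj L (dV i) = dV i) (hdV0 : ∀ i, dV i ≠ 0)
      (μ : Literature.NumberTheory.Automorphic.IdeleClassGroup L →ₜ* Circle) (hμ : IsConjugateSymplectic L μ)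
      (χf : UnitaryGroup.finAdelicOne (↥(maximalRealSubfield L)) L (IsCMField.complexConj L) →* ℂˣ),
      Continuous χf →
      ∀ (v : HeightOneSpectrum (𝓞 ↥(maximalRealSubfield L))),
        (∀ w : PlacesOver L v, IsCMField.complexConj L • w.1 = w.1) →
        ∀ (ε₀ : (↥(maximalRealSubfield L))ˣ) (ψθ : ↥(normOneUnits (conjLocal L (IsCMField.complexConj L) v)) →* ℂˣ),
          IsThetaCenterChar L μ χf ε₀ v ψθ →
          ∃ ε : (↥(maximalRealSubfield L))ˣ,
            OccursInLineWeilCM L e₀ (kernelLineCM dV) (complexConj_kernelLineCM dV hdV) (kernelLineCM_ne_zero dV hdV0) μ hμ ε v ψθ := by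
  intro L _ _ _ n₀ e₀ dV hdV hdV0 μ hμ χf hχ v hv ε₀ ψθ hθ
  obtain ⟨θ, hθn⟩ := exists_units_not_isNorm_of_nonsplit L v hv
  have hcont := continuous_of_isThetaCenterChar L μ χf hχ ε₀ v ψθ hθ
  have hq : ((θ * ε₀) * ε₀⁻¹ : (↥(maximalRealSubfield L))ˣ) = θ := mul_inv_cancel_right θ ε₀
  have key := (hD L e₀ (kernelLineCM dV) (complexConj_kernelLineCM dV hdV) (kernelLineCM_ne_zero dV hdV0) μ hμ v hv ε₀ (θ * ε₀)
    (by rw [hq]; exact hθn) ψθ hcont).1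
  rcases key with h | h
  · exact ⟨ε₀, h⟩
  · exact ⟨θ * ε₀, h⟩


/-! ## §4 (ED.2) Open kernel of the theta centre character; characters with open kernel are continuous -/

/-- **A `ℂˣ`-valued character with open kernel is continuous** (it is constant on the cosets of its open kernel). [folklore]
[cite: BernsteinZelevinsky1976, §2.1] -/
theorem continuous_coe_of_isOpen_ker {G : Type*} [Group G] [TopologicalSpace G] [ContinuousMul G] (ψ : G →* ℂˣ)
    (h : IsOpen (ψ.ker : Set G)) : Continuous fun g => ((ψ g : ℂˣ) : ℂ) := by
  refine IsLocallyConstant.continuous ((IsLocallyConstant.iff_eventually_eq _).2 fun g => ?_)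
  have ho : IsOpen ((fun y => g⁻¹ * y) ⁻¹' (ψ.ker : Set G)) := h.preimage (continuous_const.mul continuous_id)
  have hg : g ∈ (fun y => g⁻¹ * y) ⁻¹' (ψ.ker : Set G) := by
    rw [Set.mem_preimage, SetLike.mem_coe, MonoidHom.mem_ker, inv_mul_cancel, map_one]
  filter_upwards [ho.mem_nhds hg] with y hy
  rw [Set.mem_preimage, SetLike.mem_coe, MonoidHom.mem_ker, map_mul, map_inv, inv_mul_eq_one] at hy
  rw [hy]

set_option synthInstance.maxHeartbeats 400000 in
set_option maxHeartbeats 8000000 in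
/-- **The theta centre character has OPEN KERNEL** (non-split `v`, `χ_f` continuous).  Pull `ψθ` back along `det ∘ localPiEquiv` to the
compact totally disconnected `U(JW ε)(L⁺_v)`: there it is `u ↦ χ_{f,v}(u)·μ_v(det u)⁻¹` (★ `IsThetaCenterChar`), continuous, hence with open
kernel (★ `UnitaryGroupNonsplitTorus.isOpen_ker_of_smul_eq`); and `ker ψθ` is the preimage of that kernel under the continuous section
`β ↦ (β)` (★ `localUnitScalar`, `det (β) = β`). [cite: BernsteinZelevinsky1976, §2.1] [cite: Mok2014, §1 Notation p. 5] -/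
theorem isOpen_ker_of_isThetaCenterChar (L : Type) [Field L] [NumberField L] [IsCMField L]
    (μ : Literature.NumberTheory.Automorphic.IdeleClassGroup L →ₜ* Circle)
    (χf : UnitaryGroup.finAdelicOne (↥(maximalRealSubfield L)) L (IsCMField.complexConj L) →* ℂˣ) (hχ : Continuous χf)
    (ε : (↥(maximalRealSubfield L))ˣ) (v : HeightOneSpectrum (𝓞 ↥(maximalRealSubfield L)))
    (hv : ∀ w : PlacesOver L v, IsCMField.complexConj L • w.1 = w.1)
    (ψθ : ↥(normOneUnits (conjLocal L (IsCMField.complexConj L) v)) →* ℂˣ) (h : IsThetaCenterChar L μ χf ε v ψθ) :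
    IsOpen (ψθ.ker : Set ↥(normOneUnits (conjLocal L (IsCMField.complexConj L) v))) := by
  have hJ : IsUnit (JW (↥(maximalRealSubfield L)) L ε).det :=
    isUnit_iff_ne_zero.mpr (by rw [Matrix.det_fin_one]; exact JW_apply_ne_zero (↥(maximalRealSubfield L)) L ε)
  obtain ⟨w⟩ := (inferInstance : Nonempty (PlacesOver L v))
  -- the pulled-back character `ξ = ψθ ∘ det ∘ localPiEquiv` on `U(JW ε)(L⁺_v)`
  set ξ : ↥(localPi L (IsCMField.complexConj L) 1 (JW (↥(maximalRealSubfield L)) L ε) v) →* ℂˣ :=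
    ψθ.comp ((localDet (IsCMField.complexConj L) v hJ).comp
      (localPiEquiv L (IsCMField.complexConj L) 1 (JW (↥(maximalRealSubfield L)) L ε) v).toMulEquiv.toMonoidHom) with hξdef
  have hξ : ∀ u, ξ u = ψθ (localDet (IsCMField.complexConj L) v hJ
      (localPiEquiv L (IsCMField.complexConj L) 1 (JW (↥(maximalRealSubfield L)) L ε) v u)) := fun u => rfl
  have hξc : Continuous fun u => ((ξ u : ℂˣ) : ℂ) := by
    have hfun : (fun u => ((ξ u : ℂˣ) : ℂ)) = fun u =>
        ((localCharOfCenter (↥(maximalRealSubfield L)) L (IsCMField.complexConj L) (JW (↥(maximalRealSubfield L)) L ε)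
            (JW_apply_ne_zero (↥(maximalRealSubfield L)) L ε) χf v u : ℂˣ) : ℂ) *
          ((((toHeckeCharacter L μ).semilocalComponent L v
              ((localDet (IsCMField.complexConj L) v hJ
                (localPiEquiv L (IsCMField.complexConj L) 1 (JW (↥(maximalRealSubfield L)) L ε) v u) :
                  ↥(normOneUnits (conjLocal L (IsCMField.complexConj L) v))) : (UnitaryGroup.LocalRing L v)ˣ))⁻¹ : ℂˣ) : ℂ) := by
      funext u; rw [hξ u, h u, Units.val_mul]
    rw [hfun]
    refine (continuous_coe_localCharOfCenter (↥(maximalRealSubfield L)) L (IsCMField.complexConj L) _ _ hχ v).mul ?_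
    exact Units.continuous_val.comp (continuous_inv.comp
      ((continuous_semilocalComponent L (v := v) (toHeckeCharacter L μ)).comp (continuous_subtype_val.comp
        ((continuous_localDet (IsCMField.complexConj L) v hJ).comp
          (localPiEquiv L (IsCMField.complexConj L) 1 (JW (↥(maximalRealSubfield L)) L ε) v).continuous))))
  have hopen : IsOpen (ξ.ker : Set ↥(localPi L (IsCMField.complexConj L) 1 (JW (↥(maximalRealSubfield L)) L ε) v)) :=
    isOpen_ker_of_smul_eq (IsCMField.complexConj L) (JW (↥(maximalRealSubfield L)) L ε) (IsCMField.complexConj_ne_one L)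
      (JW_apply_ne_zero (↥(maximalRealSubfield L)) L ε) w (hv w) ξ hξc
  -- the section `β ↦ (β)` and `ker ψθ = s ⁻¹' ker ξ`
  set s : ↥(normOneUnits (conjLocal L (IsCMField.complexConj L) v)) →
      ↥(localPi L (IsCMField.complexConj L) 1 (JW (↥(maximalRealSubfield L)) L ε) v) := fun β =>
    localUnitScalar L (IsCMField.complexConj L) (JW (↥(maximalRealSubfield L)) L ε) v (β : (UnitaryGroup.LocalRing L v)ˣ)
      (by rw [mul_comm]; exact (mem_normOneUnits_iff (β : (UnitaryGroup.LocalRing L v)ˣ)).1 β.2) with hsdef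
  have hs : Continuous s := continuous_localUnitScalar_normOneUnits L (IsCMField.complexConj L) _ v
  have hdet : ∀ β, localDet (IsCMField.complexConj L) v hJ
      (localPiEquiv L (IsCMField.complexConj L) 1 (JW (↥(maximalRealSubfield L)) L ε) v (s β)) = β := fun β =>
    Subtype.ext (localDet_localPiEquiv_localUnitScalar L (IsCMField.complexConj L) _ v hJ _ _)
  have heq : (ψθ.ker : Set ↥(normOneUnits (conjLocal L (IsCMField.complexConj L) v))) =
      s ⁻¹' (ξ.ker : Set ↥(localPi L (IsCMField.complexConj L) 1 (JW (↥(maximalRealSubfield L)) L ε) v)) := by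
    ext β
    rw [Set.mem_preimage, SetLike.mem_coe, SetLike.mem_coe, MonoidHom.mem_ker, MonoidHom.mem_ker, hξ, hdet]
  rw [heq]
  exact hopen.preimage hs

/-! ## §5 (ED.2) K1occ under the PRINT LETTER ★ `u1ThetaDichotomy_nonsplit` (p826953), and that letter from the dichotomy in CM currency

Lead B-p18 (g28) 15:23:45Z (2): the letter-sourced twin, so that edition v3b can fold K1aʷ under ONE letter binder `hU1` today; when
F0P2-p06's θ-pinning (`hD`) lands, `u1ThetaDichotomy_nonsplit_holds := u1ThetaDichotomy_nonsplit_of_dichotomy ‹p06›` retires the letter. -/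

set_option synthInstance.maxHeartbeats 400000 in
set_option maxHeartbeats 8000000 in
/-- **K1occ under the `(U(1),U(1))` dichotomy LETTER ★ `GelbartRogawski1991.u1ThetaDichotomy_nonsplit`** (two-sided existence form,
continuity hypothesis, ED.2 p827180): the theta centre character is continuous (§1 `continuous_of_isThetaCenterChar`), so ★ `u1Occurrence_exists hU1`
applies at the Witt kernel line.  CONDITIONAL on the letter `hU1` (print: HKS96 Cor. 4.4 (m = n = 1), Rogawski1992 Prop. 3.4).
[cite: HarrisKudlaSweet1996, Cor. 4.4 (m = n = 1) p. 962] [cite: GelbartRogawski1991, Remark p. 466] -/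
theorem k1occ_of_u1ThetaDichotomy (hU1 : Literature.NumberTheory.GelbartRogawski1991.u1ThetaDichotomy_nonsplit) :
    ∀ (L : Type) [Field L] [NumberField L] [IsCMField L]
      {n₀ : ℕ} (e₀ : Fin 1 × Fin 1 ≃ Fin n₀) (dV : Fin 3 → L) (hdV : ∀ i, IsCMField.complexConj L (dV i) = dV i) (hdV0 : ∀ i, dV i ≠ 0)
      (μ : Literature.NumberTheory.Automorphic.IdeleClassGroup L →ₜ* Circle) (hμ : IsConjugateSymplectic L μ)
      (χf : UnitaryGroup.finAdelicOne (↥(maximalRealSubfield L)) L (IsCMField.complexConj L) →* ℂˣ),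
      Continuous χf →
      ∀ (v : HeightOneSpectrum (𝓞 ↥(maximalRealSubfield L))),
        (∀ w : PlacesOver L v, IsCMField.complexConj L • w.1 = w.1) →
        ∀ (ε₀ : (↥(maximalRealSubfield L))ˣ) (ψθ : ↥(normOneUnits (conjLocal L (IsCMField.complexConj L) v)) →* ℂˣ),
          IsThetaCenterChar L μ χf ε₀ v ψθ →
          ∃ ε : (↥(maximalRealSubfield L))ˣ,
            OccursInLineWeilCM L e₀ (kernelLineCM dV) (complexConj_kernelLineCM dV hdV) (kernelLineCM_ne_zero dV hdV0) μ hμ ε v ψθ :=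
  fun L _ _ _ _ e₀ dV hdV hdV0 μ hμ χf hχ v hv ε₀ ψθ hθ =>
    u1Occurrence_exists hU1 L e₀ (kernelLineCM dV) (complexConj_kernelLineCM dV hdV) (kernelLineCM_ne_zero dV hdV0) μ hμ v hv ψθ
      (continuous_of_isThetaCenterChar L μ χf hχ ε₀ v ψθ hθ)

set_option synthInstance.maxHeartbeats 400000 in
set_option maxHeartbeats 8000000 in
/-- **The letter ★ `u1ThetaDichotomy_nonsplit` FROM the dichotomy in CM currency `hD`** («of two line classes differing by a local
non-norm exactly one carries `ψ`»; the text `F0/P2/p01/HDICH-binder.v2.F0P2p01g7.lean`, in-house target of F0P2-p06 (g0)): a character with open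
letter's `ψ` is continuous by hypothesis (ED.2 p827180), a global non-norm `θ` exists (§2), and `hD` at the pair `(1, θ)` yields an occurring and a non-occurring line.  So
`u1ThetaDichotomy_nonsplit_holds := u1ThetaDichotomy_nonsplit_of_dichotomy ‹hD proved›` pays the letter by one token.
[cite: HarrisKudlaSweet1996, Cor. 4.4 (m = n = 1) p. 962] [cite: GelbartRogawski1991, Remark p. 466] -/
theorem u1ThetaDichotomy_nonsplit_of_dichotomy
    (hD : ∀ (L : Type) [Field L] [NumberField L] [IsCMField L]
      {n₀ : ℕ} (e₀ : Fin 1 × Fin 1 ≃ Fin n₀) (dL : Fin 1 → L) (hdL : ∀ i, IsCMField.complexConj L (dL i) = dL i) (hdL0 : ∀ i, dL i ≠ 0)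
      (μ : Literature.NumberTheory.Automorphic.IdeleClassGroup L →ₜ* Circle) (hμ : IsConjugateSymplectic L μ)
      (v : HeightOneSpectrum (𝓞 ↥(maximalRealSubfield L))),
      (∀ w : PlacesOver L v, IsCMField.complexConj L • w.1 = w.1) →
      ∀ (ε₁ ε₂ : (↥(maximalRealSubfield L))ˣ),
        (¬ ∃ x : (UnitaryGroup.LocalRing L v)ˣ,
            (x : UnitaryGroup.LocalRing L v) * conjLocal L (IsCMField.complexConj L) v x =
              algebraMap L (UnitaryGroup.LocalRing L v) (((ε₂ * ε₁⁻¹ : (↥(maximalRealSubfield L))ˣ) : ↥(maximalRealSubfield L)) : L)) →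
        ∀ (ψ : ↥(normOneUnits (conjLocal L (IsCMField.complexConj L) v)) →* ℂˣ),
          (Continuous fun β => ((ψ β : ℂˣ) : ℂ)) →
          (OccursInLineWeilCM L e₀ dL hdL hdL0 μ hμ ε₁ v ψ ∨ OccursInLineWeilCM L e₀ dL hdL hdL0 μ hμ ε₂ v ψ) ∧
            ¬ (OccursInLineWeilCM L e₀ dL hdL hdL0 μ hμ ε₁ v ψ ∧ OccursInLineWeilCM L e₀ dL hdL hdL0 μ hμ ε₂ v ψ)) :
    Literature.NumberTheory.GelbartRogawski1991.u1ThetaDichotomy_nonsplit := by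
  intro L _ _ _ n₀ e₀ dL hdL hdL0 μ hμ v hv ψ hψ
  obtain ⟨θ, hθn⟩ := exists_units_not_isNorm_of_nonsplit L v hv
  have hq : ((θ * 1) * 1⁻¹ : (↥(maximalRealSubfield L))ˣ) = θ := by rw [mul_one, inv_one, mul_one]
  obtain ⟨hor, hnand⟩ := hD L e₀ dL hdL hdL0 μ hμ v hv 1 (θ * 1) (by rw [hq]; exact hθn) ψ hψ
  refine ⟨?_, ?_⟩
  · rcases hor with h | h
    · exact ⟨1, h⟩
    · exact ⟨θ * 1, h⟩
  · by_cases h1 : OccursInLineWeilCM L e₀ dL hdL hdL0 μ hμ 1 v ψ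
    · exact ⟨θ * 1, fun h2 => hnand ⟨h1, h2⟩⟩
    · exact ⟨1, h1⟩

end Summit.HodgeConjecture.HodgeConjecture.Cruxes.H413.F0P2oK1occ

end
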